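import Literature.Geometry.MetricGeometry.Ultralimit
import Mathlib.Topology.Algebra.SeparationQuotient.Basic
import Mathlib.Topology.MetricSpace.IsometricSMul
import HarnessLib

/-!
# The limit group of isometric actions on an ultralimit

Huang–Huang–Wang–Zhu 2026, Thm 2.1 (arXiv:2605.24380, §2.1 p. 6, after Fukaya–Yamaguchi): "Let
`(Xᵢ, pᵢ)` … converge … For each `i`, let `Gᵢ` be a closed subgroup of `Isom(Xᵢ)`. Then passing
to a subsequence if necessary, `(Xᵢ, pᵢ, Gᵢ) → (X, p, G)`, where `G` is a closed subgroup of
`Isom(X)`", applied in §4 (p. 13) to the deck groups `Hᵢ` of the covers `M̂ᵢ`: "Obviously, `X` is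
compact, and `H` is Abelian", "`diam(ℝˢ/G) ≤ 1`". With the limit space realised as the ultralimit
`lim_U (Xᵢ, pᵢ)` (`Ultralimit.lean`, `PointedGHPrecompactness.lean`) the limit group has a direct
description, formalised here: sequences `gᵢ ∈ Γᵢ` of isometries with BOUNDED DISPLACEMENT of the
base points act, coordinatewise, by isometries on the admissible sequences and on the ultralimit.

* `admissibleSubgroup Γ p` — the subgroup of `Π Γᵢ` of sequences with `sup d(gᵢ pᵢ, pᵢ) < ∞`;
* its isometric actions on `PreUltralimit p U` and on `Ultralimit p U`
  (`instIsIsometricSMul…`), the homomorphism `limitHom` to the isometry group and its range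
  `limitGroup Γ p U ≤ Isom(lim_U Xᵢ)`;
* `limitGroup_mul_comm` — **limits of abelian actions are abelian** ("`H` is Abelian");
* `exists_mem_limitGroup_dist_basePt_le` — **cocompactness passes to the limit**: if every `Γᵢ`
  moves every point of `Xᵢ` into `B̄(pᵢ, D)`, then `limitGroup` moves every point of the
  ultralimit into `B̄(basePt, D)` ("`diam(ℝˢ/G) ≤ 1`" for the covers with `diam Mᵢ ≤ 1`).

(The closedness of the limit group and the equivariant approximation maps of Fukaya–Yamaguchi's
definition are not treated here; additive/deck-group actions enter through `Multiplicative`.)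
Everything is a definition with body or a proved theorem; no named facts.

## References

* K. Fukaya, T. Yamaguchi, Ann. of Math. 136 (1992) 253–333, §3 (equivariant pointed Hausdorff
  convergence, Prop. 3.6). (Context.)
* H. Huang, X.-T. Huang, J. Wang, X. Zhu, arXiv:2605.24380 (2026), §2.1 p. 6 Thm 2.1; §4 p. 13.
  [HuangHuangWangZhu2026]
-/

noncomputable section

open Set Filter Metric Topology

namespace Literature.Geometry.MetricGeometry

variable {X : ℕ → Type*} [∀ i, PseudoMetricSpace (X i)]
  {Γ : ℕ → Type*} [∀ i, Group (Γ i)] [∀ i, MulAction (Γ i) (X i)] [∀ i, IsIsometricSMul (Γ i) (X i)]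

/-! ### §1. Admissible sequences of isometries -/

variable (Γ) (p : ∀ i, X i)

/-- **Admissible sequences of isometries**: `gᵢ ∈ Γᵢ` with bounded displacement of the base
points, `sup_i d(gᵢ pᵢ, pᵢ) < ∞` — a subgroup of `Π Γᵢ` (the family of groups `Γ` is an explicit
argument). [cite: HuangHuangWangZhu2026, §2.1 p. 6 Thm 2.1] -/
def admissibleSubgroup : Subgroup (∀ i, Γ i) where
  carrier := {g | ∃ C : ℝ, ∀ i, dist (g i • p i) (p i) ≤ C}
  one_mem' := ⟨0, fun i ↦ by simp⟩
  mul_mem' := by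
    rintro g h ⟨Cg, hg⟩ ⟨Ch, hh⟩
    refine ⟨Ch + Cg, fun i ↦ ?_⟩
    calc dist ((g * h) i • p i) (p i) = dist (g i • h i • p i) (p i) := by rw [Pi.mul_apply, mul_smul]
      _ ≤ dist (g i • h i • p i) (g i • p i) + dist (g i • p i) (p i) := dist_triangle _ _ _
      _ = dist (h i • p i) (p i) + dist (g i • p i) (p i) := by rw [dist_smul]
      _ ≤ Ch + Cg := add_le_add (hh i) (hg i)
  inv_mem' := by
    rintro g ⟨C, hg⟩
    refine ⟨C, fun i ↦ ?_⟩
    calc dist (g⁻¹ i • p i) (p i) = dist (g i • g⁻¹ i • p i) (g i • p i) := (dist_smul _ _ _).symm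
      _ = dist (p i) (g i • p i) := by rw [Pi.inv_apply, smul_inv_smul]
      _ ≤ C := by rw [dist_comm]; exact hg i

variable {Γ p}

/-- Membership in the admissible subgroup. [cite: HuangHuangWangZhu2026, §2.1 p. 6 Thm 2.1] -/
theorem mem_admissibleSubgroup_iff {g : ∀ i, Γ i} :
    g ∈ admissibleSubgroup Γ p ↔ ∃ C : ℝ, ∀ i, dist (g i • p i) (p i) ≤ C :=
  Iff.rfl

/-! ### §2. The isometric action on admissible sequences and on the ultralimit -/

namespace PreUltralimit

variable {U : Ultrafilter ℕ}

/-- Two admissible sequences with the same underlying sequence are equal. [folklore] -/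
@[ext] theorem ext {x y : PreUltralimit p U} (h : x.seq = y.seq) : x = y := by
  cases x; cases y; cases h; rfl

/-- **Admissible isometries act on admissible sequences** coordinatewise:
`(gᵢ) • (xᵢ) = (gᵢ xᵢ)` (the displacement bound keeps the sequence admissible).
[cite: HuangHuangWangZhu2026, §2.1 p. 6 Thm 2.1] -/
instance instSMulAdmissible : SMul (admissibleSubgroup Γ p) (PreUltralimit p U) where
  smul g x := ⟨fun i ↦ (g : ∀ i, Γ i) i • x.seq i, by
    obtain ⟨Cg, hg⟩ := g.2
    obtain ⟨Cx, hx⟩ := x.bdd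
    refine ⟨Cx + Cg, fun i ↦ ?_⟩
    calc dist ((g : ∀ i, Γ i) i • x.seq i) (p i)
        ≤ dist ((g : ∀ i, Γ i) i • x.seq i) ((g : ∀ i, Γ i) i • p i) +
            dist ((g : ∀ i, Γ i) i • p i) (p i) := dist_triangle _ _ _
      _ = dist (x.seq i) (p i) + dist ((g : ∀ i, Γ i) i • p i) (p i) := by rw [dist_smul]
      _ ≤ Cx + Cg := add_le_add (hx i) (hg i)⟩

/-- The underlying sequence of `g • x`. [cite: HuangHuangWangZhu2026, §2.1 p. 6 Thm 2.1] -/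
@[simp] theorem smul_seq (g : admissibleSubgroup Γ p) (x : PreUltralimit p U) (i : ℕ) :
    (g • x).seq i = (g : ∀ i, Γ i) i • x.seq i :=
  rfl

/-- The action is a group action. [cite: HuangHuangWangZhu2026, §2.1 p. 6 Thm 2.1] -/
instance instMulActionAdmissible : MulAction (admissibleSubgroup Γ p) (PreUltralimit p U) where
  one_smul x := by ext i; simp
  mul_smul g h x := by ext i; simp [mul_smul]

/-- **The action is isometric** (`d(gᵢ xᵢ, gᵢ yᵢ) = d(xᵢ, yᵢ)` coordinatewise).
[cite: HuangHuangWangZhu2026, §2.1 p. 6 Thm 2.1] -/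
instance instIsIsometricSMulAdmissible : IsIsometricSMul (admissibleSubgroup Γ p) (PreUltralimit p U) :=
  ⟨fun g ↦ Isometry.of_dist_eq fun x y ↦ by
    show ulimReal U _ = ulimReal U _
    simp only [smul_seq, dist_smul]⟩

/-- The displacement of the base sequence by an admissible `g` with `d(gᵢ pᵢ, pᵢ) ≤ C` is `≤ C`.
[cite: HuangHuangWangZhu2026, §2.1 p. 6 Thm 2.1] -/
theorem dist_smul_base_le {g : admissibleSubgroup Γ p} {C : ℝ}
    (h : ∀ i, dist ((g : ∀ i, Γ i) i • p i) (p i) ≤ C) :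
    dist (g • base p U) (base p U) ≤ C :=
  dist_le_of_eventually_le (Eventually.of_forall fun i ↦ by simpa using h i)

end PreUltralimit

namespace Ultralimit

variable {U : Ultrafilter ℕ}

/-- The action descends to the ultralimit: `g • [x] = [g • x]`.
[cite: HuangHuangWangZhu2026, §2.1 p. 6 Thm 2.1] -/
theorem smul_mk (g : admissibleSubgroup Γ p) (x : PreUltralimit p U) :
    g • (mk x : Ultralimit p U) = mk (g • x) :=
  (SeparationQuotient.mk_smul g x).symm

/-- **The limit action is isometric.** [cite: HuangHuangWangZhu2026, §2.1 p. 6 Thm 2.1] -/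
instance instIsIsometricSMulAdmissible : IsIsometricSMul (admissibleSubgroup Γ p) (Ultralimit p U) :=
  ⟨fun g ↦ Isometry.of_dist_eq fun y y' ↦ by
    obtain ⟨x, rfl⟩ := mk_surjective y
    obtain ⟨x', rfl⟩ := mk_surjective y'
    rw [smul_mk, smul_mk, dist_mk, dist_mk, dist_smul]⟩

variable (Γ p U) in
/-- **The homomorphism to the isometry group of the ultralimit** (the family of groups `Γ` is an
explicit argument).
[cite: HuangHuangWangZhu2026, §2.1 p. 6 Thm 2.1] -/
def limitHom : admissibleSubgroup Γ p →* (Ultralimit p U ≃ᵢ Ultralimit p U) where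
  toFun g := IsometryEquiv.constSMul g
  map_one' := by ext y; simp [IsometryEquiv.constSMul]
  map_mul' g h := by ext y; simp [IsometryEquiv.constSMul, mul_smul]

/-- `limitHom g` acts as `g`. [cite: HuangHuangWangZhu2026, §2.1 p. 6 Thm 2.1] -/
@[simp] theorem limitHom_apply (g : admissibleSubgroup Γ p) (y : Ultralimit p U) :
    limitHom Γ p U g y = g • y :=
  rfl

variable (Γ p U) in
/-- **The limit group** `G ≤ Isom(lim_U Xᵢ)`: the isometries of the ultralimit induced by
admissible sequences of isometries. [cite: HuangHuangWangZhu2026, §2.1 p. 6 Thm 2.1] -/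
def limitGroup : Subgroup (Ultralimit p U ≃ᵢ Ultralimit p U) :=
  (limitHom Γ p U).range

/-- Membership in the limit group. [cite: HuangHuangWangZhu2026, §2.1 p. 6 Thm 2.1] -/
theorem mem_limitGroup_iff {A : Ultralimit p U ≃ᵢ Ultralimit p U} :
    A ∈ limitGroup Γ p U ↔ ∃ g : admissibleSubgroup Γ p, limitHom Γ p U g = A :=
  MonoidHom.mem_range

/-- **Limits of abelian actions are abelian** ("`H` is Abelian", Huang–Huang–Wang–Zhu 2026, §4
p. 13): if every `Γᵢ` is commutative, so is the limit group. [cite: HuangHuangWangZhu2026, §4 p. 13] -/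
theorem limitGroup_mul_comm (hcomm : ∀ i, ∀ a b : Γ i, a * b = b * a)
    {A B : Ultralimit p U ≃ᵢ Ultralimit p U} (hA : A ∈ limitGroup Γ p U) (hB : B ∈ limitGroup Γ p U) :
    A * B = B * A := by
  obtain ⟨g, rfl⟩ := mem_limitGroup_iff.1 hA
  obtain ⟨h, rfl⟩ := mem_limitGroup_iff.1 hB
  rw [← map_mul, ← map_mul]
  congr 1
  ext i
  exact hcomm i _ _

/-- **Cocompactness passes to the limit** ("`diam(ℝˢ/G) ≤ 1`", Huang–Huang–Wang–Zhu 2026, §4 p. 13,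
for covers of manifolds of diameter `≤ 1`): if every `Γᵢ` moves every point of `Xᵢ` into
`B̄(pᵢ, D)`, then every point of the ultralimit is moved into `B̄(basePt, D)` by an element of the
limit group (choose `gᵢ` with `d(gᵢ xᵢ, pᵢ) ≤ D`; the sequence is admissible because `(xᵢ)` is).
[cite: HuangHuangWangZhu2026, §4 p. 13] -/
theorem exists_mem_limitGroup_dist_basePt_le {D : ℝ}
    (hD : ∀ i, ∀ x : X i, ∃ g : Γ i, dist (g • x) (p i) ≤ D) (y : Ultralimit p U) :
    ∃ A ∈ limitGroup Γ p U, dist (A y) (basePt p U) ≤ D := by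
  obtain ⟨x, rfl⟩ := mk_surjective y
  choose g hg using fun i ↦ hD i (x.seq i)
  obtain ⟨Cx, hx⟩ := x.bdd
  have hadm : g ∈ admissibleSubgroup Γ p := by
    refine ⟨Cx + D, fun i ↦ ?_⟩
    calc dist (g i • p i) (p i) ≤ dist (g i • p i) (g i • x.seq i) + dist (g i • x.seq i) (p i) :=
          dist_triangle _ _ _
      _ = dist (p i) (x.seq i) + dist (g i • x.seq i) (p i) := by rw [dist_smul]
      _ ≤ Cx + D := add_le_add (by rw [dist_comm]; exact hx i) (hg i)
  refine ⟨limitHom Γ p U ⟨g, hadm⟩, mem_limitGroup_iff.2 ⟨⟨g, hadm⟩, rfl⟩, ?_⟩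
  rw [limitHom_apply, smul_mk, basePt, dist_mk]
  exact PreUltralimit.dist_le_of_eventually_le (Eventually.of_forall fun i ↦ by simpa using hg i)

/-- The displacement of the base point by the limit of `g` with `d(gᵢ pᵢ, pᵢ) ≤ C` is `≤ C`.
[cite: HuangHuangWangZhu2026, §2.1 p. 6 Thm 2.1] -/
theorem dist_smul_basePt_le {g : admissibleSubgroup Γ p} {C : ℝ}
    (h : ∀ i, dist ((g : ∀ i, Γ i) i • p i) (p i) ≤ C) :
    dist (g • basePt p U) (basePt p U) ≤ C := by
  rw [basePt, smul_mk, dist_mk]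
  exact PreUltralimit.dist_smul_base_le h

end Ultralimit

end Literature.Geometry.MetricGeometry
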